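import Summits.QuantumFields.YangMills.Theses.AllWindowsColdBox
import Summits.QuantumFields.YangMills.Theorems.AllWindowsColdBoxBoxHighLineLandauSecondOrder
import Summits.QuantumFields.YangMills.Theorems.AllWindowsColdBoxBoxHighLineLandauClosers
import Summits.QuantumFields.YangMills.Theorems.AllWindowsColdBoxBoxHighLineHodgePoincareStub
import Summits.QuantumFields.YangMills.Theorems.AllWindowsColdBoxBoxHighLineKernelHodgeForm

/-!
# ⟨stmt-QuantumFields-24335⟩ BY NAME — the LOW sub-window `1/16 < θ ≤ 1/13` of the cold-box two-point domination for `SU(2)`: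
# `BoxWindowLowSU2213_proof : Summit.QuantumFields.YangMills.Theses.AllWindowsColdBox.BoxWindowLowSU2213`
# (LINE-19 «landau-sector-relative-bl», skeleton `Cruxes/BoxHighWindowsSU22/Lines/landau_sector_relative_bl.lean` v13 composition
# `BoxWindowLowSU2213_of`, now with every stub a tree theorem; LEAD ym-line-sfw-p2 g77, planner ym-idea-2 g18; hands: width seat w3 g40)

The skeleton's composition, transcribed on the Theorems side with the landed stubs BY NAME:
S1 ✓`stub_hodgePoincare`, S2 ✓`stub_kernelHodgeForm`, S3 ✓`stub_landauKernelBounds`, S4 ✓`stub_gaugeBallReduction`, S4b ✓`stub_landauRepresentative`,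
S5 ✓`landauSecondOrder` (this generation's STEP 2: 13A w2 g31, 13D/13u/13f₀/13K-U/K3 fcl-p3 g26, 13K-G/E + T-S5.6 w4 g27/g28, 13n/13K-K4 w5 g22/g23,
10/11/12a/13m/final step LEAD g77, 7b/7c/7d/7e/6s/6b/L5(ii)/budgets w3 g40, 6a/7a/12d w2, …) and the bulk currency ✓`boxWindow_of_dirichletDominationBulk_ceiling`
at the split point `θL = 1/13 < 5/64`.

HONEST LABEL: this closes the LOW route item ⟨stmt-QuantumFields-24335⟩ (`BoxWindowLowSU2213`, windows `1/16 < θ ≤ 1/13`, `θ ≤ 7A`) — ONE conjunct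
toward the crux ⟨stmt-QuantumFields-24004⟩ `BoxHighWindowsSU22`, whose HIGH residual ⟨stmt-QuantumFields-24336⟩ (`θ > 1/13`, RG/Bałaban class) is
OPEN and not attacked by this line; no rung above it and no summit is proved; **the Yang–Mills mass gap is NOT proved by this file; no summit is
proved by a line.**
-/

set_option autoImplicit false

namespace Summit.QuantumFields.YangMills.Theorems.AllWindowsColdBoxBoxHighLine

/-- The bulk relative Dirichlet comparison at every `θL < 5/64`, all stub inputs discharged BY NAME. -/
theorem landauRelativeComparisonBulk_of_lt {θL : ℝ} (hθL : θL < 5 / 64) : LandauRelativeComparisonBulk θL :=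
  landauSecondOrder θL hθL stub_hodgePoincare stub_kernelHodgeForm stub_landauKernelBounds stub_landauRepresentative
    (stub_gaugeBallReduction θL (lt_trans hθL (by norm_num)))

/-- The LOW child `BoxWindowLowSU22 θL` shape for every `θL < 5/64` (Theorems-side letters): cold-box two-point domination for all windows
`0 < A < θ ≤ θL`. -/
theorem boxTwoPointDomination_of_le {θL : ℝ} (hθL : θL < 5 / 64) (A θ : ℝ) (hA : 0 < A) (hAθ : A < θ) (hθ : θ ≤ θL) :
    ∃ c : ℝ, 0 < c ∧ Summit.QuantumFields.YangMills.Theorems.WeakCouplingRates.BoxTwoPointDomination (G := SU2)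
      (Literature.MathematicalPhysics.QuantumLattice.fundamentalRep (Fin 2)) A θ c :=
  boxWindow_of_dirichletDominationBulk_ceiling θL (landauRelativeComparisonBulk_of_lt hθL) A θ hA hAθ hθ

/-- ★★★ **⟨stmt-QuantumFields-24335⟩ `BoxWindowLowSU2213` BY NAME**: the LOW sub-window `1/16 < θ ≤ 1/13` (`θ ≤ 7A`) of the one-scale
cold-box two-point domination for `SU(2)`. -/
theorem BoxWindowLowSU2213_proof : Summit.QuantumFields.YangMills.Theses.AllWindowsColdBox.BoxWindowLowSU2213 :=
  fun A θ hA hAθ _h7 _h16 hθ13 => boxTwoPointDomination_of_le (θL := 1 / 13) (by norm_num) A θ hA hAθ hθ13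

end Summit.QuantumFields.YangMills.Theorems.AllWindowsColdBoxBoxHighLine
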